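import Literature.AlgebraicGeometry.HodgeTheory.HodgeModelExistenceProofs
import Literature.AlgebraicGeometry.Motives.GAGAKaehlerImmersionProofs
import HarnessLib

/-!
# Hodge models of a smooth projective variety are compact Kähler (crux
# `EndoscopicMiddleDegree.OrthogonalEnveloped`, stmt-HodgeConjecture-14300; `--supports`)

The registered stub `stub_modelKaehlerCompact` (stub L4 of the line purity-sorted-hecke-envelope):
for a smooth projective `X/ℂ` of dimension `p` and ANY Hodge model `A : HodgeModel p X`, the
carrier `A.carrier` is a compact space and a Kähler manifold (charted on `A.model`).

Proof. COMPACT: the comparison map `A.toComplexPoints : A.carrier → X(ℂ)` is a homeomorphism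
(`A.isAnalytification.homeomorph`) and `X(ℂ)` is compact for `X` smooth projective
(`compactSpace_complexPoints_of_isSmoothProjective`: `X → Spec ℂ` proper, Hartshorne II.4.9; proper
⇒ compact, Serre, GAGA §2 n°7 Prop. 6), so `A.carrier` is compact (`Homeomorph.compactSpace`).
KÄHLER: `X` is smooth of relative dimension `p` (`IsSmoothProjective.smoothOfRelativeDimension`) and
admits a closed immersion `ι : X ⟶ ℙᴺ_ℂ` (`IsSmoothProjective.isProjectiveOver`); the tree's PROVED
`Motives.isKaehlerManifold_of_isAnalytification_of_isClosedImmersion_holds` (the Fubini–Study metric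
pulled back along the induced holomorphic embedding `A.carrier ↪ ℙᴺ(ℂ)`, Voisin I §3.3.2 p. 77) fed
with `A.isAnalytification` gives `IsKaehlerManifold A.model A.carrier`, the `IsManifold` instances
(holomorphic and real `C^∞`) being those recorded in the Hodge model.

References: C. Voisin, *Hodge Theory and Complex Algebraic Geometry I* (2002), §3.3.2 p. 77;
J.-P. Serre, *Géométrie algébrique et géométrie analytique* (1956), §2 n°5 Prop. 2, n°7 Prop. 6.
-/

noncomputable section

-- The crux-workfile namespace `Summit.<P>.<Sub>.Cruxes.…` repeats `HodgeConjecture` (single-conjunct summit).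
set_option linter.dupNamespace false

namespace Summit.HodgeConjecture.HodgeConjecture.Cruxes.OrthogonalEnveloped.PuritySortedHeckeEnvelope

open scoped Manifold ContDiff
open Literature.AlgebraicGeometry.Motives (SchemeOver ComplexPoints IsSmoothProjective)
open Literature.AlgebraicGeometry.HodgeTheory
open Literature.Geometry.Kaehler (IsKaehlerManifold)

/-- **Stub L4 — Hodge models are compact Kähler.** The carrier of a Hodge model of a smooth projective
`X` is compact (homeomorphic to `X(ℂ)`, `compactSpace_complexPoints_of_isSmoothProjective`) and Kähler (every
analytification of a smooth projective variety is: pulled-back Fubini–Study metric,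
`Motives.isKaehlerManifold_of_isAnalytification_of_isClosedImmersion_holds`, fed `A.isAnalytification`, a
projective embedding `IsSmoothProjective.isProjectiveOver` and `IsSmoothProjective.smoothOfRelativeDimension`).
[cite: VoisinHodgeI2002, §3.3.2 p. 77] [cite: SerreGAGA1956, §2 n°5 Prop. 2] -/
theorem stub_modelKaehlerCompact :
    ∀ {p : ℕ} {X : SchemeOver ℂ}, IsSmoothProjective p X → ∀ A : HodgeModel p X,
      CompactSpace A.carrier ∧ IsKaehlerManifold A.model A.carrier := by
  intro p X hX A
  refine ⟨?_, ?_⟩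
  · -- `A.carrier ≃ₜ X(ℂ)` and `X(ℂ)` is compact
    haveI : CompactSpace (ComplexPoints X) := compactSpace_complexPoints_of_isSmoothProjective hX
    exact A.isAnalytification.homeomorph.symm.compactSpace
  · -- the pulled-back Fubini–Study metric along a projective embedding `ι : X ⟶ ℙᴺ_ℂ`
    haveI : AlgebraicGeometry.SmoothOfRelativeDimension p X.hom := hX.smoothOfRelativeDimension
    obtain ⟨N, ι, hι⟩ := hX.isProjectiveOver
    exact Literature.AlgebraicGeometry.Motives.isKaehlerManifold_of_isAnalytification_of_isClosedImmersion_holds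
      (k := ℂ) (X := X) (d := p) (E := A.model) (M := A.carrier) (φ := A.toComplexPoints) ι
      A.isAnalytification

end Summit.HodgeConjecture.HodgeConjecture.Cruxes.OrthogonalEnveloped.PuritySortedHeckeEnvelope

end
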